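import Summits.CriticalPhenomena.PercolationContinuityZ3.Theorems.Transplant.FKConnectivityAllQCountReweightedFKG
import Summits.CriticalPhenomena.PercolationContinuityZ3.Theorems.Transplant.FKConnectivityAllQArborealLimit
import Summits.CriticalPhenomena.PercolationContinuityZ3.Theorems.Transplant.FKConnectivityAllQArborealContraction
import HarnessLib

/-!
# Log-convexity is NECESSARY: if the hub inequality (resp. MM) holds under `μ_{w,h} ∝ P_w·h(k)` for all edge parameters on `n ≥ 3`
# vertices, then `h(n−1)² ≤ h(n−2)·h(n)` — the three-vertex path is TIGHT for `φ_{w,q}` and decides the sign for general `h`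

Support file (`--supports stmt-CriticalPhenomena-4575`), FK sub-lane `prim-bschramm-fk-1` (gen 10) of the post-continuity programme;
builds on p205010 (kernel theorem, internal audit signed; external expert review pending).  No new definitions, no named facts, no
sorries; standard axioms.

On `V = Fin n` (`n ≥ 3`) take three vertices `0, 1, 2`, all other pairs at parameter `0` (so only the configurations inside the two
chosen pairs carry weight, and `k` takes the values `n, n−1, n−2`):
* HUB (`sum_crWeight_pair`, `exists_hub_iff_logConvexAt`, **`logConvexAt_of_hub`**, `logConvex_of_hub_all`): on the path `0 – 1 – 2` with parameters `½, ½`,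
  `μ(0↔1)μ(2↔1) ≤ μ(Ω)μ(0↔1↔2)` is EQUIVALENT to `h(n−1)² ≤ h(n−2)h(n)` (`Z·h(n−2) − (h(n−1)+h(n−2))² = h(n)h(n−2) − h(n−1)²` after the
  common factor `¼`).  Hence: if the hub inequality holds under `crMeasure w h` for every `w` on `Fin n`, then `h` is log-convex at `n−1`;
  and if it holds on all finite weighted graphs then `h` is log-convex at every index `≥ 2` (`logConvex_of_hub_all`).
* MM (`exists_mm_iff_logConvexAt`, **`logConvexAt_of_clusterDomAdj`**): with `f = s(0,1)` switched and `g = s(0,2)` at parameter `½`: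
  `μ_{w[f↦0]}(0↔2) = h(n−1)/(h(n)+h(n−1))` and `μ_{w[f↦1]}(0↔2) = h(n−2)/(h(n−1)+h(n−2))`, so MM at this instance is again
  `h(n−1)² ≤ h(n−2)h(n)`.
For `h = q^k` both are equalities (the path is a TIGHT cell of the hub/MM census for every `q`), which is why the sign for a general count
weight is decided by the second difference of `log h` — the mechanism behind this seat's census dichotomy (GEN/AG-loc/MM/hub hold for
every log-convex `h` tested and fail for every non-log-convex one).  Companion files: `…CountReweightedFKG` (FKG for non-decreasing
log-convex `h`), `…CountReweightedClusterDomDefs` (node `ClusterDomAdjLogConvexPos` = the converse, conjectural), `…CountReweightedCex`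
(kernel witnesses for `h(k) = k+1`).
[cite: Grimmett2006, §1.4 eq. (1.20) (p. 15); §3.9 (pp. 63–65)] [cite: AyyerLinussonRavichandran2025, §7 eq. (15) (p. 22)]
-/

noncomputable section

namespace Summit.CriticalPhenomena.PercolationContinuityZ3.Theorems

namespace FK

open MeasureTheory Set Literature.Probability.LatticeModels Literature.Probability.Percolation
open Literature.Probability.Percolation.TwoAvoidanceSets (ind_mul_ind)
open scoped Classical
open BHK2006 DecisionTree

variable {V : Type*} [Fintype V]

/-! ### Sums for a weight vector supported on two pairs -/

omit [Fintype V] in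
/-- A configuration contained in `{p, q}` is one of `∅, {p}, {q}, {p, q}`. [folklore] -/
theorem eq_of_subset_pair {p q : Sym2 V} {ω : BondConfig V} (h : ω ⊆ {p, q}) :
    ω = ∅ ∨ ω = {p} ∨ ω = {q} ∨ ω = {p, q} := by
  by_cases hp : p ∈ ω <;> by_cases hq : q ∈ ω
  · right; right; right
    exact Set.Subset.antisymm h (by intro e he; rcases he with rfl | rfl <;> assumption)
  · right; left
    refine Set.Subset.antisymm (fun e he => ?_) (by intro e he; rw [Set.mem_singleton_iff.1 he]; exact hp)
    rcases h he with rfl | h' <;> [rfl; exact absurd (Set.mem_singleton_iff.1 h' ▸ he) hq]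
  · right; right; left
    refine Set.Subset.antisymm (fun e he => ?_) (by intro e he; rw [Set.mem_singleton_iff.1 he]; exact hq)
    rcases h he with rfl | h' <;> [exact absurd he hp; exact h']
  · left
    refine Set.eq_empty_iff_forall_notMem.2 fun e he => ?_
    rcases h he with rfl | h' <;> [exact hp he; exact hq (Set.mem_singleton_iff.1 h' ▸ he)]

/-- If some pair of `ω` has parameter `0`, the count weight vanishes. [folklore] -/
theorem crWeight_eq_zero_of_mem_zero (u : Sym2 V → unitInterval) (h : ℕ → ℝ) {ω : BondConfig V} {e : Sym2 V} (he : e ∈ ω)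
    (hu : u e = 0) : crWeight u h ω = 0 := by
  unfold crWeight
  rw [weight_eq_factor_mul _ e, if_pos he]
  simp [hu]

/-- **The product weight of a configuration inside the two-pair support**: for `u` vanishing off `{p, q}` (`p ≠ q`) and `ω ⊆ {p,q}`,
`weight_u(ω) = (u_p or 1−u_p)·(u_q or 1−u_q)`. [folklore] -/
theorem weight_of_subset_pair (u : Sym2 V → unitInterval) {p q : Sym2 V} (hpq : p ≠ q) (hu : ∀ e, e ≠ p → e ≠ q → u e = 0)
    {ω : BondConfig V} (hω : ω ⊆ {p, q}) :
    weight (fun e => (u e : ℝ)) ω =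
      (if p ∈ ω then (u p : ℝ) else 1 - (u p : ℝ)) * (if q ∈ ω then (u q : ℝ) else 1 - (u q : ℝ)) := by
  rw [weight_eq_factor_mul _ p]
  have hq : q ∈ Finset.univ.erase p := Finset.mem_erase.2 ⟨hpq.symm, Finset.mem_univ q⟩
  rw [← Finset.mul_prod_erase _ _ hq]
  have hrest : ∏ e ∈ (Finset.univ.erase p).erase q, (if e ∈ ω then (u e : ℝ) else 1 - (u e : ℝ)) = 1 := by
    refine Finset.prod_eq_one fun e he => ?_
    have heq : e ≠ q := Finset.ne_of_mem_erase he
    have hep : e ≠ p := Finset.ne_of_mem_erase (Finset.mem_of_mem_erase he)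
    have hnot : e ∉ ω := fun h' => by rcases hω h' with rfl | h'' <;> [exact hep rfl; exact heq h'']
    rw [if_neg hnot, hu e hep heq]; simp
  rw [hrest, mul_one]

/-- **Sums against a count weight supported on two pairs** reduce to the four configurations `∅, {p}, {q}, {p,q}`.
[cite: Grimmett2006, §1.4 eq. (1.20) (p. 15)] -/
theorem sum_crWeight_pair (u : Sym2 V → unitInterval) (h : ℕ → ℝ) {p q : Sym2 V} (hpq : p ≠ q)
    (hu : ∀ e, e ≠ p → e ≠ q → u e = 0) (F : BondConfig V → ℝ) :
    ∑ ω : BondConfig V, crWeight u h ω * F ω =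
      (1 - (u p : ℝ)) * (1 - (u q : ℝ)) * h (clusterCount (∅ : BondConfig V) ∅) * F ∅ +
      (u p : ℝ) * (1 - (u q : ℝ)) * h (clusterCount ({p} : BondConfig V) ∅) * F {p} +
      (1 - (u p : ℝ)) * (u q : ℝ) * h (clusterCount ({q} : BondConfig V) ∅) * F {q} +
      (u p : ℝ) * (u q : ℝ) * h (clusterCount ({p, q} : BondConfig V) ∅) * F {p, q} := by
  have hne1 : (∅ : BondConfig V) ≠ {p} := fun h' => by have := h' ▸ (Set.mem_singleton p); exact this
  have hne2 : (∅ : BondConfig V) ≠ {q} := fun h' => by have := h' ▸ (Set.mem_singleton q); exact this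
  have hne3 : (∅ : BondConfig V) ≠ {p, q} := fun h' => by have : p ∈ (∅ : BondConfig V) := h' ▸ Set.mem_insert p {q}; exact this
  have hne4 : ({p} : BondConfig V) ≠ {q} := fun h' => hpq (Set.singleton_eq_singleton_iff.1 h')
  have hne5 : ({p} : BondConfig V) ≠ {p, q} := fun h' => by
    have : q ∈ ({p} : BondConfig V) := h' ▸ Set.mem_insert_of_mem p (Set.mem_singleton q)
    exact hpq (Set.mem_singleton_iff.1 this).symm
  have hne6 : ({q} : BondConfig V) ≠ {p, q} := fun h' => by
    have : p ∈ ({q} : BondConfig V) := h' ▸ Set.mem_insert p {q}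
    exact hpq (Set.mem_singleton_iff.1 this)
  let T : Finset (BondConfig V) := {∅, {p}, {q}, {p, q}}
  have hsub : T ⊆ Finset.univ := Finset.subset_univ _
  rw [← Finset.sum_subset hsub (fun ω _ hω => ?_)]
  · simp only [T, Finset.sum_insert, Finset.mem_insert, Finset.mem_singleton, hne1, hne2, hne3, hne4, hne5, hne6, or_self,
      not_false_eq_true, Finset.sum_singleton]
    unfold crWeight
    rw [weight_of_subset_pair u hpq hu (Set.empty_subset _), weight_of_subset_pair u hpq hu (Set.singleton_subset_iff.2 (Set.mem_insert p {q})),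
      weight_of_subset_pair u hpq hu (Set.singleton_subset_iff.2 (Set.mem_insert_of_mem p (Set.mem_singleton q))),
      weight_of_subset_pair u hpq hu Set.Subset.rfl]
    simp only [Set.mem_empty_iff_false, if_false, Set.mem_singleton_iff, if_true, hpq.symm, hpq, Set.mem_insert_iff, true_or, or_true]
    ring
  · -- off the four configurations the weight vanishes
    have hnot : ¬ ω ⊆ {p, q} := by
      intro h'
      rcases eq_of_subset_pair h' with rfl | rfl | rfl | rfl <;> simp [T] at hω
    obtain ⟨e, heω, he⟩ := Set.not_subset.1 hnot
    have hep : e ≠ p := fun h' => he (by rw [h']; exact Set.mem_insert p {q})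
    have heq : e ≠ q := fun h' => he (by rw [h']; exact Set.mem_insert_of_mem p (Set.mem_singleton q))
    rw [crWeight_eq_zero_of_mem_zero u h heω (hu e hep heq), zero_mul]

/-! ### Cluster counts and connections of the small configurations -/

omit [Fintype V] in
/-- A set of vertices closed under the adjacency of `openGraph ω` and containing `u` contains everything reachable from `u`. [folklore] -/
theorem not_reachable_of_closed (ω : BondConfig V) {S : Set V} (hS : ∀ a ∈ S, ∀ b, (openGraph ω).Adj a b → b ∈ S) {u v : V}
    (hu : u ∈ S) (hv : v ∉ S) : ¬ (openGraph ω).Reachable u v := by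
  intro hr
  rw [SimpleGraph.reachable_iff_reflTransGen] at hr
  have key : ∀ b, Relation.ReflTransGen (openGraph ω).Adj u b → b ∈ S := by
    intro b hb
    induction hb with
    | refl => exact hu
    | @tail a b _ hab ih => exact hS a ih b hab
  exact hv (key v hr)

omit [Fintype V] in
/-- In the one-pair configuration `{s(a,b)}` nothing outside `{a, b}` is reachable from `a` or `b`. [folklore] -/
theorem not_reachable_single {a b u c : V} (hu : u = a ∨ u = b) (hca : c ≠ a) (hcb : c ≠ b) :
    ¬ (openGraph ({s(a, b)} : BondConfig V)).Reachable u c := by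
  refine not_reachable_of_closed _ (S := {a, b}) (fun x _ y hxy => ?_) ?_ ?_
  · rw [openGraph_adj] at hxy
    have h1 : s(x, y) = s(a, b) := Set.mem_singleton_iff.1 hxy.1
    rcases Sym2.eq_iff.1 h1 with ⟨-, hy⟩ | ⟨-, hy⟩
    · rw [hy]; exact Set.mem_insert_of_mem a (Set.mem_singleton b)
    · rw [hy]; exact Set.mem_insert a {b}
  · rcases hu with h | h
    · rw [h]; exact Set.mem_insert a {b}
    · rw [h]; exact Set.mem_insert_of_mem a (Set.mem_singleton b)
  · intro hc
    rcases hc with rfl | hc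
    · exact hca rfl
    · exact hcb (Set.mem_singleton_iff.1 hc)

omit [Fintype V] in
/-- A single pair joins its endpoints. [folklore] -/
theorem reachable_of_mem {ω : BondConfig V} {a b : V} (hab : a ≠ b) (h : s(a, b) ∈ ω) : (openGraph ω).Reachable a b :=
  SimpleGraph.Adj.reachable ((openGraph_adj ω a b).2 ⟨h, hab⟩)

omit [Fintype V] in
/-- The empty configuration joins nothing. [folklore] -/
theorem not_reachable_empty {a b : V} (hab : a ≠ b) : ¬ (openGraph (∅ : BondConfig V)).Reachable a b := by
  have hbot : openGraph (∅ : BondConfig V) = ⊥ := by ext x y; simp [openGraph]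
  rw [hbot, SimpleGraph.reachable_bot]
  exact hab

omit [Fintype V] in
/-- One non-loop pair is a forest. [folklore] -/
theorem isForestCfg_single {a b : V} (hab : a ≠ b) : IsForestCfg ({s(a, b)} : BondConfig V) := by
  have h := (isForestCfg_insert_iff hab (ω := (∅ : BondConfig V)) (Set.notMem_empty _)).2
    ⟨isForestCfg_empty, not_reachable_empty hab⟩
  have he : (insert s(a, b) ∅ : BondConfig V) = {s(a, b)} := by ext e; simp
  rwa [he] at h

omit [Fintype V] in
/-- A path of two pairs `s(a,b), s(b,c)` (`a, b, c` distinct) is a forest. [folklore] -/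
theorem isForestCfg_path {a b c : V} (hab : a ≠ b) (hbc : b ≠ c) (hac : a ≠ c) :
    IsForestCfg ({s(b, c), s(a, b)} : BondConfig V) := by
  have hnot : s(b, c) ∉ ({s(a, b)} : BondConfig V) := by
    intro h'
    rcases Sym2.eq_iff.1 (Set.mem_singleton_iff.1 h') with ⟨h1, -⟩ | ⟨-, h2⟩
    · exact hab h1.symm
    · exact hac h2.symm
  exact (isForestCfg_insert_iff hbc hnot).2 ⟨isForestCfg_single hab, not_reachable_single (Or.inr rfl) hac.symm hbc.symm⟩

/-- Cluster counts of the small configurations: `k(∅) = |V|`, `k({ab}) = |V| − 1`, `k({ab, bc}) = |V| − 2`. [folklore] -/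
theorem clusterCount_single {a b : V} (hab : a ≠ b) : clusterCount ({s(a, b)} : BondConfig V) ∅ + 1 = Fintype.card V := by
  have h := (card_le_card_add_clusterCount_and_iff ({s(a, b)} : Finset (Sym2 V))).2.2 (by
    rw [Finset.coe_singleton]; exact isForestCfg_single hab)
  rw [Finset.card_singleton, Finset.coe_singleton] at h
  omega

/-- `k({ab, bc}) + 2 = |V|`. [folklore] -/
theorem clusterCount_path {a b c : V} (hab : a ≠ b) (hbc : b ≠ c) (hac : a ≠ c) :
    clusterCount ({s(b, c), s(a, b)} : BondConfig V) ∅ + 2 = Fintype.card V := by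
  have hne : s(b, c) ≠ s(a, b) := by
    intro h'
    rcases Sym2.eq_iff.1 h' with ⟨h1, -⟩ | ⟨-, h2⟩
    · exact hab h1.symm
    · exact hac h2.symm
  have h := (card_le_card_add_clusterCount_and_iff ({s(b, c), s(a, b)} : Finset (Sym2 V))).2.2 (by
    rw [Finset.coe_insert, Finset.coe_singleton]; exact isForestCfg_path hab hbc hac)
  rw [Finset.card_insert_of_notMem (by rwa [Finset.mem_singleton]), Finset.card_singleton, Finset.coe_insert, Finset.coe_singleton] at h
  omega

/-! ### The hub inequality on the three-vertex path ⟺ log-convexity at `|V| − 1` -/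

/-- **The hub inequality on the path `o – a – b` (parameters `½`, all other pairs `0`) is EQUIVALENT to
`h(|V|−1)² ≤ h(|V|−2)·h(|V|)`** (`h > 0`, `o, a, b` distinct).  For `h = q^k` both sides are equal: the path is a tight cell.
[cite: AyyerLinussonRavichandran2025, §7 eq. (15) (p. 22)] [cite: Grimmett2006, §1.4 eq. (1.20) (p. 15)] -/
theorem exists_hub_iff_logConvexAt {h : ℕ → ℝ} (hpos : ∀ k, 0 < h k) {o a b : V} (hoa : o ≠ a) (hab : a ≠ b) (hob : o ≠ b) :
    ∃ u : Sym2 V → unitInterval, (HubUnder (crMeasure u h) o a b ↔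
      h (Fintype.card V - 1) * h (Fintype.card V - 1) ≤ h (Fintype.card V - 2) * h (Fintype.card V)) := by
  let hf : unitInterval := ⟨1 / 2, by norm_num, by norm_num⟩
  let u : Sym2 V → unitInterval := fun e => if e = s(o, a) ∨ e = s(a, b) then hf else 0
  refine ⟨u, ?_⟩
  have pathW_p : ((u s(o, a) : unitInterval) : ℝ) = 1 / 2 := by simp [u, hf]
  have pathW_q : ((u s(a, b) : unitInterval) : ℝ) = 1 / 2 := by simp [u, hf]
  have hpq : s(o, a) ≠ s(a, b) := by
    intro h'
    rcases Sym2.eq_iff.1 h' with ⟨h1, -⟩ | ⟨h1, -⟩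
    · exact hoa h1
    · exact hob h1
  have hu : ∀ e, e ≠ s(o, a) → e ≠ s(a, b) → u e = 0 := fun e h1 h2 => by simp [u, h1, h2]
  have hZ := crPartition_pos u hpos
  have kE : clusterCount (∅ : BondConfig V) ∅ = Fintype.card V := clusterCount_empty_card
  have kP : clusterCount ({s(o, a)} : BondConfig V) ∅ = Fintype.card V - 1 := by
    have := clusterCount_single (V := V) hoa; omega
  have kQ : clusterCount ({s(a, b)} : BondConfig V) ∅ = Fintype.card V - 1 := by
    have := clusterCount_single (V := V) hab; omega
  have kPQ : clusterCount ({s(o, a), s(a, b)} : BondConfig V) ∅ = Fintype.card V - 2 := by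
    have h1 := clusterCount_path (V := V) hab.symm hoa.symm hob.symm
    have hset : ({s(a, o), s(b, a)} : BondConfig V) = {s(o, a), s(a, b)} := by rw [Sym2.eq_swap (a := a) (b := o), Sym2.eq_swap (a := b) (b := a)]
    rw [hset] at h1; omega
  have r_oa_P : ({s(o, a)} : BondConfig V) ∈ (openConn o a : Set (BondConfig V)) := reachable_of_mem hoa (Set.mem_singleton _)
  have r_oa_PQ : ({s(o, a), s(a, b)} : BondConfig V) ∈ (openConn o a : Set (BondConfig V)) := reachable_of_mem hoa (Set.mem_insert _ _)
  have n_oa_E : (∅ : BondConfig V) ∉ (openConn o a : Set (BondConfig V)) := not_reachable_empty hoa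
  have n_oa_Q : ({s(a, b)} : BondConfig V) ∉ (openConn o a : Set (BondConfig V)) := fun hr =>
    not_reachable_single (a := a) (b := b) (Or.inl rfl) hoa hob (SimpleGraph.Reachable.symm hr)
  have r_ba_Q : ({s(a, b)} : BondConfig V) ∈ (openConn b a : Set (BondConfig V)) := by
    have hsw : s(b, a) = s(a, b) := Sym2.eq_swap
    exact reachable_of_mem hab.symm (by rw [hsw]; exact Set.mem_singleton _)
  have r_ba_PQ : ({s(o, a), s(a, b)} : BondConfig V) ∈ (openConn b a : Set (BondConfig V)) := by
    have hsw : s(b, a) = s(a, b) := Sym2.eq_swap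
    exact reachable_of_mem hab.symm (by rw [hsw]; exact Set.mem_insert_of_mem _ (Set.mem_singleton _))
  have n_ba_E : (∅ : BondConfig V) ∉ (openConn b a : Set (BondConfig V)) := not_reachable_empty hab.symm
  have n_ba_P : ({s(o, a)} : BondConfig V) ∉ (openConn b a : Set (BondConfig V)) := fun hr =>
    not_reachable_single (a := o) (b := a) (Or.inr rfl) hob.symm hab.symm (SimpleGraph.Reachable.symm hr)
  have eZ : ∑ ω : BondConfig V, crWeight u h ω * ind (univ : Set (BondConfig V)) ω =
      1 / 4 * (h (Fintype.card V) + h (Fintype.card V - 1) + h (Fintype.card V - 1) + h (Fintype.card V - 2)) := by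
    rw [sum_crWeight_pair u h hpq hu, pathW_p, pathW_q, kE, kP, kQ, kPQ]
    simp only [ind_of_mem (Set.mem_univ _)]; ring
  have eOA : ∑ ω : BondConfig V, crWeight u h ω * ind (openConn o a : Set (BondConfig V)) ω =
      1 / 4 * (h (Fintype.card V - 1) + h (Fintype.card V - 2)) := by
    rw [sum_crWeight_pair u h hpq hu, pathW_p, pathW_q, kP, kPQ, ind_of_not_mem n_oa_E, ind_of_mem r_oa_P, ind_of_not_mem n_oa_Q,
      ind_of_mem r_oa_PQ]; ring
  have eBA : ∑ ω : BondConfig V, crWeight u h ω * ind (openConn b a : Set (BondConfig V)) ω =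
      1 / 4 * (h (Fintype.card V - 1) + h (Fintype.card V - 2)) := by
    rw [sum_crWeight_pair u h hpq hu, pathW_p, pathW_q, kQ, kPQ, ind_of_not_mem n_ba_E, ind_of_not_mem n_ba_P, ind_of_mem r_ba_Q,
      ind_of_mem r_ba_PQ]; ring
  have eBoth : ∑ ω : BondConfig V, crWeight u h ω * ind (openConn o a ∩ openConn b a : Set (BondConfig V)) ω =
      1 / 4 * h (Fintype.card V - 2) := by
    rw [sum_crWeight_pair u h hpq hu, pathW_p, pathW_q, kPQ, ind_of_not_mem (fun hm => n_oa_E hm.1),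
      ind_of_not_mem (fun hm => n_ba_P hm.2), ind_of_not_mem (fun hm => n_oa_Q hm.1), ind_of_mem (Set.mem_inter r_oa_PQ r_ba_PQ)]; ring
  have hZ' : crPartition u h = 1 / 4 * (h (Fintype.card V) + h (Fintype.card V - 1) + h (Fintype.card V - 1) + h (Fintype.card V - 2)) := by
    rw [← eZ]; unfold crPartition; exact Finset.sum_congr rfl fun ω _ => by rw [ind_of_mem (Set.mem_univ _), mul_one]
  unfold HubUnder
  rw [crMeasure_real_eq_sum_div u hpos, crMeasure_real_eq_sum_div u hpos, crMeasure_real_eq_sum_div u hpos,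
    crMeasure_real_eq_sum_div u hpos, eZ, eOA, eBA, eBoth, hZ', div_mul_div_comm, div_mul_div_comm,
    div_le_div_iff_of_pos_right (by rw [← hZ']; exact mul_pos hZ hZ)]
  have h0 := hpos (Fintype.card V); have h1 := hpos (Fintype.card V - 1); have h2 := hpos (Fintype.card V - 2)
  constructor
  · intro hh; nlinarith [hh]
  · intro hh; nlinarith [hh]

/-- **If the hub inequality holds under `μ_{w,h}` for every weight vector on `V` (`|V| ≥ 3`), then `h` is log-convex at `|V| − 1`.**
[cite: AyyerLinussonRavichandran2025, §7 eq. (15) (p. 22)] [cite: Grimmett2006, §3.9 (pp. 63–65)] -/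
theorem logConvexAt_of_hub {h : ℕ → ℝ} (hpos : ∀ k, 0 < h k) {o a b : V} (hoa : o ≠ a) (hab : a ≠ b) (hob : o ≠ b)
    (hhub : ∀ w : Sym2 V → unitInterval, HubUnder (crMeasure w h) o a b) :
    h (Fintype.card V - 1) * h (Fintype.card V - 1) ≤ h (Fintype.card V - 2) * h (Fintype.card V) :=
  by obtain ⟨u, hu⟩ := exists_hub_iff_logConvexAt hpos hoa hab hob; exact hu.1 (hhub u)

/-- **Log-convexity is necessary for the hub inequality on all finite weighted graphs**: if for every `n`, every `w` on `Fin n` and all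
`o, a, b` the hub inequality holds under `crMeasure w h`, then `h(m)² ≤ h(m−1)h(m+1)` for every `m ≥ 2` (take the path on `Fin (m+1)`).
[cite: AyyerLinussonRavichandran2025, §7 eq. (15) (p. 22)] [cite: Grimmett2006, §3.9 (pp. 63–65)] -/
theorem logConvex_of_hub_all {h : ℕ → ℝ} (hpos : ∀ k, 0 < h k)
    (hhub : ∀ (n : ℕ) (w : Sym2 (Fin n) → unitInterval) (o a b : Fin n), HubUnder (crMeasure w h) o a b) {m : ℕ} (hm : 2 ≤ m) :
    h m * h m ≤ h (m - 1) * h (m + 1) := by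
  have h3 : 3 ≤ m + 1 := by omega
  have key := logConvexAt_of_hub (V := Fin (m + 1)) hpos (o := ⟨0, by omega⟩) (a := ⟨1, by omega⟩) (b := ⟨2, by omega⟩)
    (by simp) (by simp) (by simp) (fun w => hhub (m + 1) w _ _ _)
  simp only [Fintype.card_fin, Nat.add_sub_cancel] at key
  have e : m + 1 - 2 = m - 1 := by omega
  rw [e] at key
  exact key

/-! ### MM on the three-vertex configuration ⟺ log-convexity at `|V| − 1` -/

/-- **MM at `x` for `f = s(x,z)`, `𝒰 = {S ∋ y}`, with `g = s(x,y)` at `½` and all other pairs `0`, is EQUIVALENT to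
`h(|V|−1)² ≤ h(|V|−2)·h(|V|)`**: `μ_{w[f↦0]}(x↔y) = h(N−1)/(h(N)+h(N−1))`, `μ_{w[f↦1]}(x↔y) = h(N−2)/(h(N−1)+h(N−2))`.
[cite: Grimmett2006, Thm. (3.21) (p. 43); §3.9 (pp. 63–65)] -/
theorem exists_mm_iff_logConvexAt {h : ℕ → ℝ} (hpos : ∀ k, 0 < h k) {x y z : V} (hxy : x ≠ y) (hxz : x ≠ z) (hyz : y ≠ z) :
    ∃ w : Sym2 V → unitInterval, ((crMeasure (Function.update w s(x, z) 0) h).real (openConn x y) ≤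
        (crMeasure (Function.update w s(x, z) 1) h).real (openConn x y) ↔
      h (Fintype.card V - 1) * h (Fintype.card V - 1) ≤ h (Fintype.card V - 2) * h (Fintype.card V)) := by
  let hf : unitInterval := ⟨1 / 2, by norm_num, by norm_num⟩
  let w : Sym2 V → unitInterval := fun e => if e = s(x, y) then hf else 0
  refine ⟨w, ?_⟩
  have hpq : s(x, y) ≠ s(x, z) := by
    intro h'
    rcases Sym2.eq_iff.1 h' with ⟨-, h1⟩ | ⟨h1, -⟩
    · exact hyz h1
    · exact hxz h1
  set u0 := Function.update w s(x, z) 0 with hu0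
  set u1 := Function.update w s(x, z) 1 with hu1
  have hu0v : ∀ e, e ≠ s(x, y) → e ≠ s(x, z) → u0 e = 0 := fun e h1 h2 => by
    rw [hu0, Function.update_of_ne h2]; simp [w, h1]
  have hu1v : ∀ e, e ≠ s(x, y) → e ≠ s(x, z) → u1 e = 0 := fun e h1 h2 => by
    rw [hu1, Function.update_of_ne h2]; simp [w, h1]
  have p0 : ((u0 s(x, y) : unitInterval) : ℝ) = 1 / 2 := by rw [hu0, Function.update_of_ne hpq]; simp [w, hf]
  have q0 : ((u0 s(x, z) : unitInterval) : ℝ) = 0 := by rw [hu0, Function.update_self]; rfl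
  have p1 : ((u1 s(x, y) : unitInterval) : ℝ) = 1 / 2 := by rw [hu1, Function.update_of_ne hpq]; simp [w, hf]
  have q1 : ((u1 s(x, z) : unitInterval) : ℝ) = 1 := by rw [hu1, Function.update_self]; rfl
  have hZ0 := crPartition_pos u0 hpos
  have hZ1 := crPartition_pos u1 hpos
  have kE : clusterCount (∅ : BondConfig V) ∅ = Fintype.card V := clusterCount_empty_card
  have kP : clusterCount ({s(x, y)} : BondConfig V) ∅ = Fintype.card V - 1 := by
    have := clusterCount_single (V := V) hxy; omega
  have kQ : clusterCount ({s(x, z)} : BondConfig V) ∅ = Fintype.card V - 1 := by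
    have := clusterCount_single (V := V) hxz; omega
  have kPQ : clusterCount ({s(x, y), s(x, z)} : BondConfig V) ∅ = Fintype.card V - 2 := by
    have h1 := clusterCount_path (V := V) hxy.symm hxz hyz
    have hset : ({s(x, z), s(y, x)} : BondConfig V) = {s(x, y), s(x, z)} := by
      rw [Sym2.eq_swap (a := y) (b := x), Set.pair_comm]
    rw [hset] at h1; omega
  have rP : ({s(x, y)} : BondConfig V) ∈ (openConn x y : Set (BondConfig V)) := reachable_of_mem hxy (Set.mem_singleton _)
  have rPQ : ({s(x, y), s(x, z)} : BondConfig V) ∈ (openConn x y : Set (BondConfig V)) := reachable_of_mem hxy (Set.mem_insert _ _)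
  have nE : (∅ : BondConfig V) ∉ (openConn x y : Set (BondConfig V)) := not_reachable_empty hxy
  have nQ : ({s(x, z)} : BondConfig V) ∉ (openConn x y : Set (BondConfig V)) := fun hr =>
    not_reachable_single (a := x) (b := z) (Or.inl rfl) hxy.symm hyz hr
  have eZ0 : crPartition u0 h = 1 / 2 * (h (Fintype.card V) + h (Fintype.card V - 1)) := by
    have e := sum_crWeight_pair u0 h hpq hu0v (fun _ => (1 : ℝ))
    simp only [mul_one] at e
    unfold crPartition; rw [e, p0, q0, kE, kP]; ring
  have eM0 : ∑ ω : BondConfig V, crWeight u0 h ω * ind (openConn x y : Set (BondConfig V)) ω = 1 / 2 * h (Fintype.card V - 1) := by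
    rw [sum_crWeight_pair u0 h hpq hu0v, p0, q0, kP, ind_of_not_mem nE, ind_of_mem rP, ind_of_not_mem nQ, ind_of_mem rPQ]; ring
  have eZ1 : crPartition u1 h = 1 / 2 * (h (Fintype.card V - 1) + h (Fintype.card V - 2)) := by
    have e := sum_crWeight_pair u1 h hpq hu1v (fun _ => (1 : ℝ))
    simp only [mul_one] at e
    unfold crPartition; rw [e, p1, q1, kQ, kPQ]; ring
  have eM1 : ∑ ω : BondConfig V, crWeight u1 h ω * ind (openConn x y : Set (BondConfig V)) ω = 1 / 2 * h (Fintype.card V - 2) := by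
    rw [sum_crWeight_pair u1 h hpq hu1v, p1, q1, kPQ, ind_of_not_mem nE, ind_of_mem rP, ind_of_not_mem nQ, ind_of_mem rPQ]; ring
  rw [crMeasure_real_eq_sum_div u0 hpos, crMeasure_real_eq_sum_div u1 hpos, eM0, eM1, eZ0, eZ1]
  have h0 := hpos (Fintype.card V); have h1 := hpos (Fintype.card V - 1); have h2 := hpos (Fintype.card V - 2)
  rw [div_le_div_iff₀ (by positivity) (by positivity)]
  constructor
  · intro hh; nlinarith [hh]
  · intro hh; nlinarith [hh]

/-- **If MM holds under `μ_{w,h}` for every weight vector on `V` (`|V| ≥ 3`) — in the explicit form `μ_{w[f↦0],h}(C_x ∈ 𝒰) ≤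
μ_{w[f↦1],h}(C_x ∈ 𝒰)` for pairs `f` at `x` and up-sets `𝒰` — then `h` is log-convex at `|V| − 1`.**
[cite: Grimmett2006, Thm. (3.21) (p. 43); §3.9 (pp. 63–65)] -/
theorem logConvexAt_of_clusterDomAdj {h : ℕ → ℝ} (hpos : ∀ k, 0 < h k) {x y z : V} (hxy : x ≠ y) (hxz : x ≠ z) (hyz : y ≠ z)
    (hMM : ∀ (w : Sym2 V → unitInterval) (𝒰 : Set (Set V)), IsUpperSet 𝒰 →
      (crMeasure (Function.update w s(x, z) 0) h).real (clusterIn x 𝒰) ≤ (crMeasure (Function.update w s(x, z) 1) h).real (clusterIn x 𝒰)) :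
    h (Fintype.card V - 1) * h (Fintype.card V - 1) ≤ h (Fintype.card V - 2) * h (Fintype.card V) := by
  obtain ⟨w, hw⟩ := exists_mm_iff_logConvexAt hpos hxy hxz hyz
  have key := hMM w {S | y ∈ S} (SoloBlindKN.isUpperSet_containing y)
  rw [clusterIn_mem_eq_openConn] at key
  exact hw.1 key

end FK

end Summit.CriticalPhenomena.PercolationContinuityZ3.Theorems

end
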